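import Summits.KontsevichZagierPeriods.Zeta5Search.Certificates.RayC5LineMajorant
import Summits.KontsevichZagierPeriods.Zeta5Search.Certificates.RayC5LineStepB
import Summits.KontsevichZagierPeriods.Zeta5Search.Certificates.RayC5LineStepPrime
import Summits.KontsevichZagierPeriods.Zeta5Search.Certificates.RayC5LineStepPrimeB
import Summits.KontsevichZagierPeriods.Zeta5Search.Certificates.RayC5LineDecay
import Summits.KontsevichZagierPeriods.Zeta5Search.Certificates.RayC5LineDecayPrime
import Summits.KontsevichZagierPeriods.Zeta5Search.Certificates.RecordRayCoeffBound
import HarnessLib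

/-!
# ζ(5) search — certificates: explicit two-heights bound for the `ζ(3)`-coefficient `W` on the ray RayC5 and its partner
(cell `pub-zeta5`, P1 g11; port of certifier 2's `Certificates/RecordRayCoeffBound.lean`, heights `Y = 4n+1, 4n`)

HONEST FRAMING: systematic search; no irrationality claim unless certified.

OUR work (Summit side). Assembly of certifier 2's two-heights method (`Certificates/EisensteinSolve.lean`) with the lattice-line
majorant of the ray RayC5 (`RayC5LineMajorant`) at the heights `Y₁ = 4n+1`, `Y₂ = 4n`:
**`coeffW_C5E_abs_le`** — for `e ∈ {0,1}` and every `n ≥ 1`: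
`|W(natB (51n) (BC5E e n))| ≤ (e^{2π(8n+1)}·S_e(4n+1) + e^{16πn}·S_e(4n)) / 1000`,
`S_e(Y) = (3/2)·√Mx_e(Y)·(25n+3)(25n+4)`. Unconditional, non-asymptotic.
-/

noncomputable section

open Finset Complex Filter Topology Real

namespace Summit.KontsevichZagierPeriods.Zeta5Search.RayC5

open Summit.KontsevichZagierPeriods.Zeta5Search.DualSeries
open Summit.KontsevichZagierPeriods.Zeta5Search.DualSeriesBounds (natB natB_zero natB_succ inBox_natB hsum_of)
open Summit.KontsevichZagierPeriods.Zeta5Search.WedgeDictionary (coeffW coeffU)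
open Summit.KontsevichZagierPeriods.Zeta5Search.DualPF
open Summit.KontsevichZagierPeriods.Zeta5Search.RecordLine (qsq exp_two_pi_ge exp_six_pi_mul_ge)

/-! ### Numerical facts about the two heights -/

/-- `e^{2π·4n} ≥ 10⁴` for `n ≥ 1` (from certifier 2's `exp_six_pi_mul_ge`). -/
theorem exp_pi_C5_mul_ge {n : ℕ} (hn : 1 ≤ n) : (10000 : ℝ) ≤ Real.exp (2 * π * (4 * n)) := by
  have h := exp_six_pi_mul_ge hn
  have hn' : (1 : ℝ) ≤ n := by exact_mod_cast hn
  have hmono : Real.exp (2 * π * (3 * n)) ≤ Real.exp (2 * π * (4 * n)) := by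
    apply Real.exp_le_exp.mpr
    have := Real.pi_pos
    nlinarith
  linarith

/-- The two `q`'s: `q₂ = q(3n) ≤ 10⁻⁴` and `q₁ = q(3n+1) ≤ q₂/400`, `0 < q₁`. -/
theorem q_facts_C5 {n : ℕ} (hn : 1 ≤ n) :
    0 < qr (4 * n + 1) ∧ qr (4 * n + 1) * 400 ≤ qr (4 * n) ∧ qr (4 * n) * 10000 ≤ 1 ∧
      qr (4 * n + 1) = qr (4 * n) * (Real.exp (2 * π))⁻¹ := by
  have hq1 := qr_pos (4 * (n : ℝ) + 1)
  have heq : qr (4 * n + 1) = qr (4 * n) * (Real.exp (2 * π))⁻¹ := by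
    unfold qr
    rw [← Real.exp_neg, ← Real.exp_add]
    congr 1; ring
  refine ⟨hq1, ?_, ?_, heq⟩
  · rw [heq]
    have hE := exp_two_pi_ge
    have hEpos : 0 < Real.exp (2 * π) := Real.exp_pos _
    have hq2 := (qr_pos (4 * (n : ℝ))).le
    calc qr (4 * n) * (Real.exp (2 * π))⁻¹ * 400 = qr (4 * n) * (400 / Real.exp (2 * π)) := by ring
      _ ≤ qr (4 * n) * 1 := by
          apply mul_le_mul_of_nonneg_left _ hq2
          rw [div_le_one hEpos]; exact hE
      _ = qr (4 * n) := mul_one _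
  · unfold qr
    have hE := exp_pi_C5_mul_ge hn
    have hEpos : 0 < Real.exp (2 * π * (4 * n)) := Real.exp_pos _
    rw [Real.exp_neg]
    calc (Real.exp (2 * π * (4 * (n : ℝ))))⁻¹ * 10000 = 10000 / Real.exp (2 * π * (4 * n)) := by ring
      _ ≤ 1 := by rw [div_le_one hEpos]; exact hE

set_option maxHeartbeats 2000000 in
/-- **The determinant of the two-heights system is positive**: `Δ(3n+1, 3n) ≥ 10·q₁·q₂²`. -/
theorem detAr_C5_lower {n : ℕ} (hn : 1 ≤ n) :
    10 * qr (4 * n + 1) * qr (4 * n) ^ 2 ≤ detAr (4 * n + 1) (4 * n) := by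
  obtain ⟨hq1pos, hq12, hq2small, -⟩ := q_facts_C5 hn
  set q₁ := qr (4 * (n : ℝ) + 1) with hq₁
  set q₂ := qr (4 * (n : ℝ)) with hq₂
  have hY1 : (0 : ℝ) < 4 * n + 1 := by positivity
  have hn1 : (1 : ℝ) ≤ n := by exact_mod_cast hn
  have hY2 : (0 : ℝ) < 4 * n := by linarith
  have hq2pos : 0 < q₂ := qr_pos _
  have hq1le : q₁ ≤ 1 / 2 := by nlinarith
  have hq2le : q₂ ≤ 1 / 2 := by nlinarith
  -- enclosures
  obtain ⟨hA2lo1, hA2hi1⟩ := Ar_mem (j := 2) (by norm_num) hY1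
  obtain ⟨hA4lo1, hA4hi1⟩ := Ar_mem (j := 4) (by norm_num) hY1
  obtain ⟨hA2lo2, hA2hi2⟩ := Ar_mem (j := 2) (by norm_num) hY2
  obtain ⟨hA4lo2, hA4hi2⟩ := Ar_mem (j := 4) (by norm_num) hY2
  rw [← hq₁] at hA2lo1 hA2hi1 hA4lo1 hA4hi1
  rw [← hq₂] at hA2lo2 hA2hi2 hA4lo2 hA4hi2
  -- kill the `(1-q)` denominators: `(1-q)^3 ≥ 1/8`, `(1-q)^5 ≥ 1/32`
  have hden3 : ∀ {q : ℝ}, 0 < q → q ≤ 1 / 2 → (3 : ℝ) ^ 2 * ((Nat.factorial 2 : ℕ) : ℝ) * q ^ 3 / (1 - q) ^ (2 + 1) ≤ 144 * q ^ 3 := by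
    intro q hq hq'
    have h1 : (1 / 8 : ℝ) ≤ (1 - q) ^ (2 + 1) := by
      have := pow_le_pow_left₀ (by norm_num : (0:ℝ) ≤ 1 / 2) (by linarith : (1 / 2 : ℝ) ≤ 1 - q) (2 + 1)
      norm_num at this ⊢; linarith
    rw [div_le_iff₀ (by positivity)]
    norm_num [Nat.factorial]
    nlinarith [pow_pos hq 3]
  have hden5 : ∀ {q : ℝ}, 0 < q → q ≤ 1 / 2 → (3 : ℝ) ^ 4 * ((Nat.factorial 4 : ℕ) : ℝ) * q ^ 3 / (1 - q) ^ (4 + 1) ≤ 62208 * q ^ 3 := by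
    intro q hq hq'
    have h1 : (1 / 32 : ℝ) ≤ (1 - q) ^ (4 + 1) := by
      have := pow_le_pow_left₀ (by norm_num : (0:ℝ) ≤ 1 / 2) (by linarith : (1 / 2 : ℝ) ≤ 1 - q) (4 + 1)
      norm_num at this ⊢; linarith
    rw [div_le_iff₀ (by positivity)]
    norm_num [Nat.factorial]
    nlinarith [pow_pos hq 3]
  have hA2hi2' : Ar 2 (4 * n) ≤ q₂ + 4 * q₂ ^ 2 + 144 * q₂ ^ 3 := by
    have := hden3 hq2pos hq2le; norm_num at hA2hi2 this ⊢; linarith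
  have hA4hi1' : Ar 4 (4 * n + 1) ≤ q₁ + 16 * q₁ ^ 2 + 62208 * q₁ ^ 3 := by
    have := hden5 hq1pos hq1le; norm_num at hA4hi1 this ⊢; linarith
  have hA2lo1' : q₁ + 4 * q₁ ^ 2 ≤ Ar 2 (4 * n + 1) := by norm_num at hA2lo1 ⊢; linarith
  have hA4lo2' : q₂ + 16 * q₂ ^ 2 ≤ Ar 4 (4 * n) := by norm_num at hA4lo2 ⊢; linarith
  have hA2pos2 : 0 ≤ Ar 2 (4 * n) := Ar_nonneg 2 hY2
  have hA4pos1 : 0 ≤ Ar 4 (4 * n + 1) := Ar_nonneg 4 hY1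
  -- Δ ≥ (q₁+4q₁²)(q₂+16q₂²) − (q₂+4q₂²+144q₂³)(q₁+16q₁²+62208q₁³)
  unfold detAr
  have hprod1 : (q₁ + 4 * q₁ ^ 2) * (q₂ + 16 * q₂ ^ 2) ≤ Ar 2 (4 * n + 1) * Ar 4 (4 * n) :=
    mul_le_mul hA2lo1' hA4lo2' (by positivity) (Ar_nonneg 2 hY1)
  have hprod2 : Ar 2 (4 * n) * Ar 4 (4 * n + 1) ≤
      (q₂ + 4 * q₂ ^ 2 + 144 * q₂ ^ 3) * (q₁ + 16 * q₁ ^ 2 + 62208 * q₁ ^ 3) :=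
    mul_le_mul hA2hi2' hA4hi1' hA4pos1 (by positivity)
  -- the polynomial margin
  have hq1q2 : q₁ ≤ q₂ / 400 := by linarith
  have hq2s : q₂ ≤ 1 / 10000 := by linarith
  have key : 10 * q₁ * q₂ ^ 2 ≤ (q₁ + 4 * q₁ ^ 2) * (q₂ + 16 * q₂ ^ 2) -
      (q₂ + 4 * q₂ ^ 2 + 144 * q₂ ^ 3) * (q₁ + 16 * q₁ ^ 2 + 62208 * q₁ ^ 3) := by
    -- = q₁q₂[12q₂ − 12q₁ − 62208q₁² − 248832q₁²q₂ − 144q₂² − 2304q₁q₂² − 8957952q₁²q₂²] − 10q₁q₂²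
    have e : (q₁ + 4 * q₁ ^ 2) * (q₂ + 16 * q₂ ^ 2) -
        (q₂ + 4 * q₂ ^ 2 + 144 * q₂ ^ 3) * (q₁ + 16 * q₁ ^ 2 + 62208 * q₁ ^ 3) - 10 * q₁ * q₂ ^ 2 =
        q₁ * q₂ * (2 * q₂ - 12 * q₁ - 62208 * q₁ ^ 2 - 248832 * q₁ ^ 2 * q₂ - 144 * q₂ ^ 2
          - 2304 * q₁ * q₂ ^ 2 - 8957952 * q₁ ^ 2 * q₂ ^ 2) := by ring
    have hbr : 0 ≤ 2 * q₂ - 12 * q₁ - 62208 * q₁ ^ 2 - 248832 * q₁ ^ 2 * q₂ - 144 * q₂ ^ 2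
          - 2304 * q₁ * q₂ ^ 2 - 8957952 * q₁ ^ 2 * q₂ ^ 2 := by
      have h1 : q₁ ^ 2 ≤ q₂ * (1 / 10000) / 160000 := by nlinarith
      have h2 : q₁ ^ 2 * q₂ ≤ q₂ * (1 / 10000) / 160000 * (1 / 10000) := by nlinarith
      have h3 : q₂ ^ 2 ≤ q₂ * (1 / 10000) := by nlinarith
      have h4 : q₁ * q₂ ^ 2 ≤ q₂ * (1 / 10000) * (1 / 10000) := by nlinarith
      have h5 : q₁ ^ 2 * q₂ ^ 2 ≤ q₂ * (1 / 10000) / 160000 * (1 / 10000) * (1 / 10000) := by nlinarith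
      nlinarith
    have : 0 ≤ q₁ * q₂ * (2 * q₂ - 12 * q₁ - 62208 * q₁ ^ 2 - 248832 * q₁ ^ 2 * q₂ - 144 * q₂ ^ 2
          - 2304 * q₁ * q₂ ^ 2 - 8957952 * q₁ ^ 2 * q₂ ^ 2) := by positivity
    linarith
  linarith

/-! ### The record ray and its partner: hypotheses of the generic bounds -/

/-- `InBox`, `Σ b_j ≤ 3b₀ + 1` for `natB (41n) (BC5E e n)`, `e ≤ 1`. -/
theorem box_C5E {e n : ℕ} (he : e ≤ 1) (hn : 1 ≤ n) :
    InBox (natB (51 * n) (BC5E e n)) ∧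
      ∑ j ∈ range 7, natB (51 * n) (BC5E e n) (j + 1) ≤ 3 * natB (51 * n) (BC5E e n) 0 + 1 :=
  ⟨inBox_natB (hle_c5E he hn), hsum_of (hsum_c5E he)⟩

/-- The lattice sum bound at one height: `S_e(Y) = (3/2)·√Mx_e(Y)·(20n+3)(20n+4)`. -/
def SYC5 (e n : ℕ) (Y : ℝ) : ℝ := 3 / 2 * (Real.sqrt (MxC5 e n Y) * ((25 * n + 3) * (25 * n + 4)))

/-- `S ≥ 0`. -/
theorem SYC5_nonneg (e n : ℕ) (Y : ℝ) : 0 ≤ SYC5 e n Y := by unfold SYC5; positivity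

/-- The step and decay certificates at the two heights, packaged for `e ∈ {0,1}`. -/
theorem certs_C5E {e n : ℕ} (he : e ≤ 1) (hn : 1 ≤ n) :
    (∀ a : ℝ, 1 / 2 ≤ a → stepDenC5 e n (4 * n) a ≤ stepNumC5 e n (4 * n) a) ∧
    (∀ a : ℝ, 25 * n ≤ a → stepDenC5 e n (4 * n) a * (a + 1 / 2) ^ 4 ≤ stepNumC5 e n (4 * n) a * (a - 1 / 2) ^ 4) ∧
    (∀ a : ℝ, 1 / 2 ≤ a → stepDenC5 e n (4 * n + 1) a ≤ stepNumC5 e n (4 * n + 1) a) ∧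
    (∀ a : ℝ, 25 * n ≤ a →
      stepDenC5 e n (4 * n + 1) a * (a + 1 / 2) ^ 4 ≤ stepNumC5 e n (4 * n + 1) a * (a - 1 / 2) ^ 4) := by
  have hn' : (1 : ℝ) ≤ n := by exact_mod_cast hn
  rcases Nat.le_one_iff_eq_zero_or_eq_one.1 he with rfl | rfl
  · simp only [Nat.cast_zero]
    exact ⟨fun a ha => stepDen_le_stepNum_C5e0d0 hn' ha, fun a ha => stepDen_decay_C5e0d0 hn' ha,
      fun a ha => stepDen_le_stepNum_C5e0d1 hn' ha, fun a ha => stepDen_decay_C5e0d1 hn' ha⟩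
  · simp only [Nat.cast_one]
    exact ⟨fun a ha => stepDen_le_stepNum_C5e1d0 hn' ha, fun a ha => stepDen_decay_C5e1d0 hn' ha,
      fun a ha => stepDen_le_stepNum_C5e1d1 hn' ha, fun a ha => stepDen_decay_C5e1d1 hn' ha⟩

/-! ### The explicit bounds -/

/-- **TWO-HEIGHTS BOUND FOR THE `ζ(3)`-COEFFICIENT, record ray / partner**: for `e ≤ 1`, `n ≥ 1`,
`|W(b_e)| ≤ (e^{2π(6n+1)}·S_e(3n+1) + e^{12πn}·S_e(3n)) / 1000`. -/
theorem coeffW_C5E_abs_le {e n : ℕ} (he : e ≤ 1) (hn : 1 ≤ n) :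
    |(coeffW (natB (51 * n) (BC5E e n)) : ℝ)| ≤
      (Real.exp (2 * π * (8 * n + 1)) * SYC5 e n (4 * n + 1) + Real.exp (16 * π * n) * SYC5 e n (4 * n)) / 1000 := by
  obtain ⟨hb, hsum⟩ := box_C5E he hn
  obtain ⟨hc2, hd2, hc1, hd1⟩ := certs_C5E he hn
  have hY1 : (0 : ℝ) < 4 * n + 1 := by positivity
  have hn' : (1 : ℝ) ≤ n := by exact_mod_cast hn
  have hY2 : (0 : ℝ) < 4 * n := by linarith
  -- the majorants at the two heights
  have hg1 := hasSum_majorC5 e n (4 * n + 1)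
  have hg2 := hasSum_majorC5 e n (4 * n)
  have hle1 : ∀ k : ℤ, ‖Rc (natB (51 * n) (BC5E e n)) ((k : ℂ) + (4 * n + 1 : ℝ) * I)‖ ≤ majorC5 e n (4 * n + 1) k :=
    fun k => norm_Rc_int_le_majorC5 he hn hY1 hc1 hd1 k
  have hle2 : ∀ k : ℤ, ‖Rc (natB (51 * n) (BC5E e n)) ((k : ℂ) + (4 * n : ℝ) * I)‖ ≤ majorC5 e n (4 * n) k :=
    fun k => norm_Rc_int_le_majorC5 he hn hY2 hc2 hd2 k
  have hΔ := detAr_C5_lower hn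
  obtain ⟨hq1pos, hq12, hq2small, hq1eq⟩ := q_facts_C5 hn
  have hq2pos : 0 < qr (4 * (n : ℝ)) := qr_pos _
  have hΔpos : 0 < detAr (4 * n + 1) (4 * n) := lt_of_lt_of_le (by positivity) hΔ
  have hW := coeffW_abs_le hb hsum hY1 hY2 hg1 hle1 hg2 hle2 hΔpos.ne'
  rw [abs_of_pos hΔpos] at hW
  -- `A₄ ≤ 1.002·q` at both heights
  have hq1le : qr (4 * (n : ℝ) + 1) ≤ 1 / 2 := by nlinarith
  have hq2le : qr (4 * (n : ℝ)) ≤ 1 / 2 := by nlinarith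
  have hA4 : ∀ {Y : ℝ}, 0 < Y → qr Y ≤ 1 / 10000 → qr Y ≤ 1 / 2 → Ar 4 Y ≤ qr Y * (1003 / 1000) := by
    intro Y hY hs hh
    obtain ⟨-, hhi⟩ := Ar_mem (j := 4) (by norm_num) hY
    have hq := qr_pos Y
    have h1 : (1 / 32 : ℝ) ≤ (1 - qr Y) ^ (4 + 1) := by
      have := pow_le_pow_left₀ (by norm_num : (0:ℝ) ≤ 1 / 2) (by linarith : (1 / 2 : ℝ) ≤ 1 - qr Y) (4 + 1)
      norm_num at this ⊢; linarith
    have h2 : (3 : ℝ) ^ 4 * ((Nat.factorial 4 : ℕ) : ℝ) * qr Y ^ 3 / (1 - qr Y) ^ (4 + 1) ≤ 62208 * qr Y ^ 3 := by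
      rw [div_le_iff₀ (by positivity)]; norm_num [Nat.factorial]; nlinarith [pow_pos hq 3]
    have hq2 : qr Y ^ 2 ≤ qr Y * (1 / 10000) := by nlinarith
    have hq3 : qr Y ^ 3 ≤ qr Y * (1 / 10000) * (1 / 10000) := by nlinarith
    have h3 : (2 : ℝ) ^ 4 * qr Y ^ 2 + 62208 * qr Y ^ 3 ≤ qr Y * (3 / 1000) := by nlinarith
    linarith
  have hA4_1 := hA4 hY1 (by linarith) hq1le
  have hA4_2 := hA4 hY2 (by linarith) hq2le
  have hS1 := SYC5_nonneg e n (4 * n + 1)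
  have hS2 := SYC5_nonneg e n (4 * n)
  -- `1/q` as exponentials
  have hinv2 : (qr (4 * (n : ℝ)))⁻¹ = Real.exp (2 * π * (4 * n)) := by
    unfold qr; rw [← Real.exp_neg]; congr 1; ring
  have hinv1 : (qr (4 * (n : ℝ) + 1))⁻¹ = Real.exp (2 * π * (4 * n + 1)) := by
    unfold qr; rw [← Real.exp_neg]; congr 1; ring
  have hexp1 : Real.exp (2 * π * (8 * n + 1)) = (qr (4 * (n : ℝ) + 1))⁻¹ * (qr (4 * (n : ℝ)))⁻¹ := by
    rw [hinv1, hinv2, ← Real.exp_add]; congr 1; ring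
  have hexp2 : Real.exp (16 * π * n) = (qr (4 * (n : ℝ)))⁻¹ * (qr (4 * (n : ℝ)))⁻¹ := by
    rw [hinv2, ← Real.exp_add]; congr 1; ring
  have hpi3 : (30 : ℝ) ≤ π ^ 3 := by
    have h := pow_le_pow_left₀ (by norm_num) Real.pi_gt_d2.le 3
    norm_num at h ⊢; linarith
  -- combine
  unfold SYC5 at *
  set S1 := 3 / 2 * (Real.sqrt (MxC5 e n (4 * n + 1)) * ((25 * n + 3) * (25 * n + 4))) with hS1def
  set S2 := 3 / 2 * (Real.sqrt (MxC5 e n (4 * n)) * ((25 * n + 3) * (25 * n + 4))) with hS2def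
  set q₁ := qr (4 * (n : ℝ) + 1) with hq₁
  set q₂ := qr (4 * (n : ℝ)) with hq₂
  calc |(coeffW (natB (51 * n) (BC5E e n)) : ℝ)|
      ≤ (Ar 4 (4 * n) * S1 + Ar 4 (4 * n + 1) * S2) / (4 * π ^ 3 * detAr (4 * n + 1) (4 * n)) := hW
    _ ≤ (q₂ * (1003 / 1000) * S1 + q₁ * (1003 / 1000) * S2) / (4 * π ^ 3 * (10 * q₁ * q₂ ^ 2)) := by
        gcongr
    _ = (1003 / 40000) / π ^ 3 * (q₁⁻¹ * q₂⁻¹ * S1 + q₂⁻¹ * q₂⁻¹ * S2) := by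
        field_simp
        ring
    _ ≤ (1 / 1000) * (q₁⁻¹ * q₂⁻¹ * S1 + q₂⁻¹ * q₂⁻¹ * S2) := by
        apply mul_le_mul_of_nonneg_right _ (by positivity)
        rw [div_le_iff₀ (by positivity)]; nlinarith
    _ = (Real.exp (2 * π * (8 * n + 1)) * S1 + Real.exp (16 * π * n) * S2) / 1000 := by
        rw [hexp1, hexp2]; ring


end Summit.KontsevichZagierPeriods.Zeta5Search.RayC5
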